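import Literature.Probability.RandomPlanarGeometry.ChordalCurveFamilyProofs
import HarnessLib

/-!
# Tails of a planar curve, first hittings after a parameter, and the alternation window lemma

Support file for the registered stub `stub_quadTransfer_noTouchCountable` (crux
`stmt-CriticalPhenomena-10268`, line hitting-tournament); pure topology of planar curves, no new
definitions (the two gadgets below are local notations for explicit terms of the tree's curve
surgery `Curve.affineClamp` / `Curve.hitParam`).

* `tail⟦c, r⟧` — the **tail** of `c : Curve ℂ` from the parameter `r ∈ [0,1]`, rescaled to `[0,1]`:
  `s ↦ c (r + (1 - r) s)`; the tree's final segment `Curve.startFrom S c` is the tail from the first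
  hitting parameter of `S` (`startFrom_eq_tail`, definitional).
* `hit⟦S, c, r⟧ ∈ [r, 1]` — the **first hitting of `S` after `r`**, read off the hitting parameter of
  the tail, so that `startFrom S tail⟦c, r⟧ = tail⟦c, hit⟦S, c, r⟧⟧` on the nose (`startFrom_tail`)
  and the trace of `stopAt S tail⟦c, r⟧` is `c '' [r, hit⟦S, c, r⟧]` (`range_stopAt_tail`).  Its three
  working properties: `le_hit` (`r ≤ hit`), `apply_hit_mem` (closed `S`, `hit < 1 ⇒ c hit ∈ S`),
  `hit_le` (`hit ≤` any later visit of `S`).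
* `stub_noTouchCountable_window` (registered sub-goal, stated abstractly for any two "next visit"
  operators with these three properties): for closed disjoint `F`, `G` and the alternating recursion
  `τ 0 = 0`, `τ (k+1) = nF (nG (τ k))`, a visit to `G` at `t` after a last visit to `F` at `α < t`
  is caught by a window: `α < nG (τ k) ≤ t ≤ τ (k+1)` for some `k`.  (Finitely many alternations
  before `α`: otherwise the interlaced monotone sequences `nG (τ k) ≤ τ (k+1)` converge to a common
  parameter at which the curve is in `F ∩ G = ∅`.)
-/

noncomputable section

open Filter Set Topology Metric
open scoped unitInterval
open Literature.Probability.RandomPlanarGeometry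

namespace Summit.CriticalPhenomena.CardyFormulaZ2.Cruxes.LagHandOff.HittingTournament

/-- The **tail** of a curve `c` from parameter `r`, rescaled to `[0,1]`: `s ↦ c (r + (1 - r) s)`
(local notation for the explicit surgery term). -/
local notation3 "tail⟦" c ", " r "⟧" =>
  (Curve.mk (ContinuousMap.comp (Curve.toContinuousMap c)
    (Curve.affineClamp (Subtype.val (r : unitInterval))
      (1 - Subtype.val (r : unitInterval)))) : Curve ℂ)

/-- The **first hitting of `S` after parameter `r`** (a parameter in `[r, 1]`, equal to `1` if the
curve does not visit `S` after `r`), read off the hitting parameter of the tail (local notation). -/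
local notation3 "hit⟦" S ", " c ", " r "⟧" =>
  (Curve.affineClamp (Subtype.val (r : unitInterval)) (1 - Subtype.val (r : unitInterval))
    ⟨Curve.hitParam S tail⟦c, r⟧, Curve.hitParam_mem_Icc S tail⟦c, r⟧⟩ : unitInterval)

/-! ### Clamped affine maps -/

/-- A convex combination `r + (1 - r) x` of `1` and `x ∈ [0,1]` with weight `r ∈ [0,1]` lies in
`[0,1]`. -/
theorem convexComb_mem_Icc (r : I) {x : ℝ} (hx : x ∈ Icc (0 : ℝ) 1) :
    (r : ℝ) + (1 - r) * x ∈ Icc (0 : ℝ) 1 := by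
  obtain ⟨hr0, hr1⟩ := r.2
  obtain ⟨hx0, hx1⟩ := hx
  constructor <;> nlinarith

/-- Value of the clamped affine map `affineClamp r (1 - r)` at a point of `[0,1]`: no clamping. -/
theorem coe_affineClamp_mk (r : I) {x : ℝ} (hx : x ∈ Icc (0 : ℝ) 1) :
    ((Curve.affineClamp r (1 - r) ⟨x, hx⟩ : I) : ℝ) = r + (1 - r) * x := by
  rw [Curve.affineClamp_apply, projIcc_of_mem _ (convexComb_mem_Icc r hx)]

/-! ### Tails -/

/-- Pointwise formula for the tail. -/
theorem tail_apply (c : Curve ℂ) (r₀ s : I) :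
    tail⟦c, r₀⟧ s = c (projIcc 0 1 zero_le_one (r₀ + (1 - r₀) * s)) := rfl

/-- The tail from `0` is the curve itself. -/
theorem tail_zero (c : Curve ℂ) : tail⟦c, 0⟧ = c := by
  apply Curve.ext
  apply ContinuousMap.ext
  intro s
  show tail⟦c, 0⟧ s = c s
  rw [tail_apply]
  congr 1
  apply Subtype.ext
  rw [projIcc_of_mem _ (convexComb_mem_Icc 0 s.2)]
  simp

/-- A tail of a tail is a tail. -/
theorem tail_tail (c : Curve ℂ) (r₀ r₁ : I) :
    tail⟦tail⟦c, r₀⟧, r₁⟧ = tail⟦c, Curve.affineClamp r₀ (1 - r₀) r₁⟧ := by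
  apply Curve.ext
  apply ContinuousMap.ext
  intro s
  show c (projIcc 0 1 zero_le_one ((r₀ : ℝ) + (1 - r₀) *
      (projIcc 0 1 zero_le_one ((r₁ : ℝ) + (1 - r₁) * s) : I))) =
    c (projIcc 0 1 zero_le_one ((Curve.affineClamp (r₀ : ℝ) (1 - r₀) r₁ : I) +
      (1 - (Curve.affineClamp (r₀ : ℝ) (1 - r₀) r₁ : I)) * s))
  congr 1
  apply Subtype.ext
  have h₁ := convexComb_mem_Icc r₁ s.2
  have hρ' : ((Curve.affineClamp r₀ (1 - r₀) r₁ : I) : ℝ) = r₀ + (1 - r₀) * r₁ :=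
    coe_affineClamp_mk r₀ r₁.2
  rw [projIcc_of_mem _ h₁, hρ']
  have key : (r₀ : ℝ) + (1 - r₀) * ((r₁ : ℝ) + (1 - r₁) * s) =
      ((r₀ : ℝ) + (1 - r₀) * r₁) + (1 - ((r₀ : ℝ) + (1 - r₀) * r₁)) * s := by ring
  simp only [key]

/-- The tree's final segment from the first hitting of `S` is the tail from the hitting parameter
(definitional). -/
theorem startFrom_eq_tail (S : Set ℂ) (c : Curve ℂ) :
    c.startFrom S = tail⟦c, (⟨c.hitParam S, c.hitParam_mem_Icc S⟩ : I)⟧ := rfl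

/-! ### First hitting after a parameter -/

/-- The value of `hit⟦S, c, r₀⟧` in terms of the hitting parameter of the tail. -/
theorem coe_hit (S : Set ℂ) (c : Curve ℂ) (r₀ : I) :
    ((hit⟦S, c, r₀⟧ : I) : ℝ) = r₀ + (1 - r₀) * Curve.hitParam S tail⟦c, r₀⟧ :=
  coe_affineClamp_mk r₀ _

/-- The final segment of a tail from its first hitting of `S` is the tail from `hit⟦S, c, r₀⟧`. -/
theorem startFrom_tail (S : Set ℂ) (c : Curve ℂ) (r₀ : I) :
    Curve.startFrom S tail⟦c, r₀⟧ = tail⟦c, hit⟦S, c, r₀⟧⟧ := by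
  rw [startFrom_eq_tail, tail_tail]

/-- `hit⟦S, c, r₀⟧` is at least `r₀`. -/
theorem le_hit (S : Set ℂ) (c : Curve ℂ) (r₀ : I) : r₀ ≤ hit⟦S, c, r₀⟧ := by
  rw [← Subtype.coe_le_coe, coe_hit]
  nlinarith [(Curve.hitParam_mem_Icc S tail⟦c, r₀⟧).1, r₀.2.2]

/-- If the first hitting after `r₀` of a closed set `S` happens before the terminal parameter, the
curve is in `S` there. -/
theorem apply_hit_mem {S : Set ℂ} (hS : IsClosed S) {c : Curve ℂ} {r₀ : I}
    (h1 : ((hit⟦S, c, r₀⟧ : I) : ℝ) < 1) : c hit⟦S, c, r₀⟧ ∈ S := by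
  have hex : ∃ x, tail⟦c, r₀⟧ x ∈ S := by
    by_contra H
    push Not at H
    have hT := Curve.hitParam_eq_one_of_forall_notMem H
    rw [coe_hit, hT] at h1
    linarith
  exact Curve.apply_hitParam_mem hS hex

/-- `hit⟦S, c, r₀⟧` is at most any parameter `r ≥ r₀` at which the curve is in `S`. -/
theorem hit_le {S : Set ℂ} {c : Curve ℂ} {r₀ r : I} (hr : r₀ ≤ r) (hS : c r ∈ S) :
    hit⟦S, c, r₀⟧ ≤ r := by
  rcases eq_or_lt_of_le r₀.2.2 with h1 | h1
  · have hr1 : (r : ℝ) = 1 := le_antisymm r.2.2 (h1 ▸ Subtype.coe_le_coe.2 hr)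
    rw [← Subtype.coe_le_coe, hr1]
    exact (hit⟦S, c, r₀⟧).2.2
  · have h1' : (0 : ℝ) < 1 - r₀ := sub_pos.2 h1
    set x : ℝ := ((r : ℝ) - r₀) / (1 - r₀) with hx
    have hx0 : 0 ≤ x := div_nonneg (sub_nonneg.2 (Subtype.coe_le_coe.2 hr)) h1'.le
    have hx1 : x ≤ 1 := by
      rw [hx, div_le_one h1']
      linarith [r.2.2]
    have hxr : (r₀ : ℝ) + (1 - r₀) * x = r := by
      rw [hx]
      field_simp
      ring
    have hmem : tail⟦c, r₀⟧ ⟨x, hx0, hx1⟩ ∈ S := by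
      rw [tail_apply]
      have : projIcc 0 1 zero_le_one ((r₀ : ℝ) + (1 - r₀) * ((⟨x, hx0, hx1⟩ : I) : ℝ)) = r := by
        apply Subtype.ext
        rw [projIcc_of_mem _ (convexComb_mem_Icc r₀ ⟨hx0, hx1⟩)]
        exact hxr
      rw [this]
      exact hS
    have hT : Curve.hitParam S tail⟦c, r₀⟧ ≤ x := Curve.hitParam_le hmem
    rw [← Subtype.coe_le_coe, coe_hit, ← hxr]
    nlinarith [mul_le_mul_of_nonneg_left hT h1'.le]

/-- The trace of the initial segment of a tail up to its first hitting of `S` is the image of the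
parameter window `[r₀, hit⟦S, c, r₀⟧]`. -/
theorem range_stopAt_tail (S : Set ℂ) (c : Curve ℂ) (r₀ : I) :
    (Curve.stopAt S tail⟦c, r₀⟧).range = c '' Icc r₀ hit⟦S, c, r₀⟧ := by
  set T : ℝ := Curve.hitParam S tail⟦c, r₀⟧ with hTdef
  have hT : T ∈ Icc (0 : ℝ) 1 := Curve.hitParam_mem_Icc S tail⟦c, r₀⟧
  have hr₀ := r₀.2
  have hh : ((hit⟦S, c, r₀⟧ : I) : ℝ) = r₀ + (1 - r₀) * T := coe_hit S c r₀
  ext z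
  constructor
  · rintro ⟨x, rfl⟩
    have hy : T * x ∈ Icc (0 : ℝ) 1 :=
      ⟨mul_nonneg hT.1 x.2.1, (mul_le_of_le_one_right hT.1 x.2.2).trans hT.2⟩
    have hr := convexComb_mem_Icc r₀ hy
    refine ⟨⟨(r₀ : ℝ) + (1 - r₀) * (T * x), hr⟩, ⟨?_, ?_⟩, ?_⟩
    · rw [← Subtype.coe_le_coe]
      show (r₀ : ℝ) ≤ r₀ + (1 - r₀) * (T * x)
      nlinarith [hy.1, hr₀.2]
    · rw [← Subtype.coe_le_coe, hh]
      show (r₀ : ℝ) + (1 - r₀) * (T * x) ≤ r₀ + (1 - r₀) * T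
      nlinarith [hr₀.2, mul_le_of_le_one_right hT.1 x.2.2]
    · show c _ = Curve.stopAt S tail⟦c, r₀⟧ x
      rw [Curve.stopAt_apply, tail_apply]
      congr 1
      apply Subtype.ext
      rw [← hTdef, projIcc_of_mem _ hy, projIcc_of_mem _ hr]
  · rintro ⟨r, ⟨hr0, hr1⟩, rfl⟩
    have hr0' : (r₀ : ℝ) ≤ r := Subtype.coe_le_coe.2 hr0
    have hr1' : (r : ℝ) ≤ r₀ + (1 - r₀) * T := hh ▸ Subtype.coe_le_coe.2 hr1
    by_cases hD : (1 - (r₀ : ℝ)) * T = 0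
    · -- degenerate window: `r = r₀`, parameter `0`
      have hrr : (r : ℝ) = r₀ := le_antisymm (by nlinarith) hr0'
      refine ⟨0, ?_⟩
      show Curve.stopAt S tail⟦c, r₀⟧ 0 = c r
      rw [Curve.stopAt_apply, tail_apply]
      congr 1
      apply Subtype.ext
      rw [hrr]
      simp [projIcc_of_mem _ hr₀]
    · have hDpos : 0 < (1 - (r₀ : ℝ)) * T :=
        lt_of_le_of_ne (mul_nonneg (sub_nonneg.2 hr₀.2) hT.1) (Ne.symm hD)
      have h1 : (1 - (r₀ : ℝ)) ≠ 0 := fun h => hD (by rw [h, zero_mul])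
      have hT0 : T ≠ 0 := fun h => hD (by rw [h, mul_zero])
      set x : ℝ := ((r : ℝ) - r₀) / ((1 - r₀) * T) with hx
      have hx0 : 0 ≤ x := div_nonneg (sub_nonneg.2 hr0') hDpos.le
      have hx1 : x ≤ 1 := by
        rw [hx, div_le_one hDpos]
        linarith
      have hTx : T * x = ((r : ℝ) - r₀) / (1 - r₀) := by
        rw [hx]
        field_simp
      have hTxmem : T * x ∈ Icc (0 : ℝ) 1 :=
        ⟨mul_nonneg hT.1 hx0, (mul_le_of_le_one_right hT.1 hx1).trans hT.2⟩
      have hxr : (r₀ : ℝ) + (1 - r₀) * (T * x) = r := by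
        rw [hTx]
        field_simp
        ring
      refine ⟨⟨x, hx0, hx1⟩, ?_⟩
      show Curve.stopAt S tail⟦c, r₀⟧ _ = c r
      rw [Curve.stopAt_apply, tail_apply]
      congr 1
      apply Subtype.ext
      rw [← hTdef]
      show ((projIcc 0 1 zero_le_one ((r₀ : ℝ) + (1 - r₀) *
        ((projIcc 0 1 zero_le_one (T * x) : I) : ℝ)) : I) : ℝ) = r
      rw [projIcc_of_mem _ hTxmem]
      show ((projIcc 0 1 zero_le_one ((r₀ : ℝ) + (1 - r₀) * (T * x)) : I) : ℝ) = r
      rw [projIcc_of_mem _ (convexComb_mem_Icc r₀ hTxmem)]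
      exact hxr

/-! ### The alternation window lemma (registered sub-goal) -/

/-- **The alternation window lemma** (sub-goal `stub_noTouchCountable_window` of
`stub_quadTransfer_noTouchCountable`), stated for any two "next visit after" operators `nF`, `nG`
of a curve `c` into closed disjoint sets `F`, `G` having the three working properties of
`hit⟦·, c, ·⟧` (`r ≤ n r`; `n r < 1 ⇒ c (n r)` is a visit; `n r ≤` any visit after `r`), and the
alternating recursion `τ 0 = 0`, `τ (k+1) = nF (nG (τ k))`.  If the curve is in `F` at `α`, in `G`
at `t > α`, and off `F` on `(α, t]`, then some `G`-arrival `nG (τ k)` lies in `(α, t]` and the next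
`F`-return `τ (k+1)` is `≥ t`.  Key step: some `τ k` exceeds `α` — otherwise the interlaced
monotone sequences `τ k ≤ nG (τ k) ≤ τ (k+1) ≤ α < 1` converge to a common parameter where the
curve is in `F ∩ G = ∅`; then take the least such `k ≥ 1`. -/
theorem stub_noTouchCountable_window : ∀ (c : Curve ℂ) (F G : Set ℂ), IsClosed F → IsClosed G → Disjoint F G → ∀ (nF nG : I → I), (∀ r, r ≤ nF r) → (∀ r, (nF r : ℝ) < 1 → c (nF r) ∈ F) → (∀ r r' : I, r ≤ r' → c r' ∈ F → nF r ≤ r') → (∀ r, r ≤ nG r) → (∀ r, (nG r : ℝ) < 1 → c (nG r) ∈ G) → (∀ r r' : I, r ≤ r' → c r' ∈ G → nG r ≤ r') → ∀ (τ : ℕ → I), τ 0 = 0 → (∀ k, τ (k + 1) = nF (nG (τ k))) → ∀ (α t : I), α < t → c α ∈ F → c t ∈ G → (∀ r : I, α < r → r ≤ t → c r ∉ F) → ∃ k, α < nG (τ k) ∧ nG (τ k) ≤ t ∧ t ≤ τ (k + 1) := by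
  intro c F G hF hG hFG nF nG hF1 hF2 hF3 hG1 hG2 hG3 τ hτ0 hτ α t hαt hα ht hno
  classical
  have hmono1 : ∀ k, τ k ≤ nG (τ k) := fun k => hG1 _
  have hmono2 : ∀ k, nG (τ k) ≤ τ (k + 1) := fun k => by rw [hτ k]; exact hF1 _
  -- some return time exceeds `α`
  have hex : ∃ k, α < τ k := by
    have hα1 : (α : ℝ) < 1 := lt_of_lt_of_le (Subtype.coe_lt_coe.2 hαt) t.2.2
    by_contra H
    push Not at H
    have hlt1 : ∀ k, ((τ k : I) : ℝ) < 1 := fun k =>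
      lt_of_le_of_lt (Subtype.coe_le_coe.2 (H k)) hα1
    have hGmem : ∀ k, c (nG (τ k)) ∈ G := fun k =>
      hG2 _ (lt_of_le_of_lt (Subtype.coe_le_coe.2 ((hmono2 k).trans (H (k + 1)))) hα1)
    have hFmem : ∀ k, c (τ (k + 1)) ∈ F := fun k => by rw [hτ k]; exact hF2 _ (hτ k ▸ hlt1 (k + 1))
    set τ' : ℕ → ℝ := fun k => ((τ k : I) : ℝ) with hτ'def
    have hmono : Monotone τ' :=
      monotone_nat_of_le_succ fun k => Subtype.coe_le_coe.2 ((hmono1 k).trans (hmono2 k))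
    have hbdd : BddAbove (range τ') := ⟨1, by rintro _ ⟨k, rfl⟩; exact (τ k).2.2⟩
    have hlim : Tendsto τ' atTop (𝓝 (⨆ k, τ' k)) := tendsto_atTop_ciSup hmono hbdd
    set L := ⨆ k, τ' k with hLdef
    have hL : L ∈ Icc (0 : ℝ) 1 :=
      ⟨(τ 0).2.1.trans (le_ciSup hbdd 0), ciSup_le fun k => (τ k).2.2⟩
    have hlimI : Tendsto τ atTop (𝓝 (⟨L, hL⟩ : I)) := tendsto_subtype_rng.2 hlim
    have hlimσ : Tendsto (fun k => nG (τ k)) atTop (𝓝 (⟨L, hL⟩ : I)) := by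
      refine tendsto_subtype_rng.2 ?_
      refine tendsto_of_tendsto_of_tendsto_of_le_of_le hlim (hlim.comp (tendsto_add_atTop_nat 1))
        (fun k => ?_) (fun k => ?_)
      · exact Subtype.coe_le_coe.2 (hmono1 k)
      · exact Subtype.coe_le_coe.2 (hmono2 k)
    have hcF : c ⟨L, hL⟩ ∈ F :=
      hF.mem_of_tendsto ((c.continuous.tendsto _).comp (hlimI.comp (tendsto_add_atTop_nat 1)))
        (Eventually.of_forall hFmem)
    have hcG : c ⟨L, hL⟩ ∈ G :=
      hG.mem_of_tendsto ((c.continuous.tendsto _).comp hlimσ) (Eventually.of_forall hGmem)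
    exact Set.disjoint_left.1 hFG hcF hcG
  -- the least such return time is a successor `τ (k+1)`; its window catches `t`
  set k₁ := Nat.find hex with hk₁def
  have hk₁ : α < τ k₁ := Nat.find_spec hex
  have hk₁0 : k₁ ≠ 0 := by
    intro h0
    rw [h0, hτ0] at hk₁
    exact absurd (Subtype.coe_lt_coe.2 hk₁) (not_lt.2 α.2.1)
  obtain ⟨k, hk⟩ : ∃ k, k₁ = k + 1 := Nat.exists_eq_succ_of_ne_zero hk₁0
  have hkle : τ k ≤ α := not_lt.1 (Nat.find_min hex (show k < k₁ by omega))
  rw [hk, hτ k] at hk₁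
  refine ⟨k, ?_, hG3 _ _ (hkle.trans hαt.le) ht, ?_⟩
  · by_contra h
    push Not at h
    exact absurd hk₁ (not_lt.2 (hF3 _ _ h hα))
  · by_contra h
    push Not at h
    rw [hτ k] at h
    have h1 : ((nF (nG (τ k)) : I) : ℝ) < 1 := lt_of_lt_of_le (Subtype.coe_lt_coe.2 h) t.2.2
    exact hno _ hk₁ h.le (hF2 _ h1)

end Summit.CriticalPhenomena.CardyFormulaZ2.Cruxes.LagHandOff.HittingTournament

end
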